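import Literature.MathematicalPhysics.QuantumLattice.HubbardLangerMattisTorus
import Literature.MathematicalPhysics.QuantumLattice.HubbardTorusLocalCertificate
import HarnessLib

/-!
# A two-mode ("two-pole") Langer–Mattis lower bound for the doped Hubbard ground-state energy, I: the two-mode frame

HONEST FRAMING (page 1): ladder R1–R4 with certified numbers; no claim on H/H₀; first certified
bounds; not a superconductivity verdict. This file is a SOUNDNESS EDGE of the pub-hubbard cell (seat
`pseudo`, `PSEUDO.md` §109 / `TO-ENG.md` §C 128): a kernel-checked lower bound on the sector
ground-state energy of the repulsive OR attractive Hubbard model at ANY filling, in certificate form,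
generalising the tree's Langer–Mattis / Kennedy–Lieb bound (`LangerMattis.groundEnergyAt_ge`, which is
sharp only at half filling and needs a bipartite graph).

## The mechanism (Langer–Mattis' frozen species, Lieb–Loss' one-body bound, a two-mode frame)

Write `H = H_↑ + H_↓`, `H_σ = T_σ + (U/2) Σ_x n_{x↑} n_{x↓}` (`LangerMattis.speciesHamiltonian`).
`H_σ` commutes with the projections `P^τ_w` (`τ ≠ σ`) freezing the other species on the site set
`w`, and on the range of `P^τ_w` it IS the free problem `dΓ_σ(A_w)`, `A_w = -tA_G + (U/2) 1_w`
(`LangerMattis.speciesHamiltonian_mul_configProj`). Langer–Mattis / Kennedy–Lieb bound `dΓ_σ(A_w)`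
by the sum of the negative eigenvalues of `A_w - (U/4)·1` uniformly in `w` — a half-filling bound.
Here instead: let `v_k` be an orthonormal eigenbasis of the hopping matrix `tA_G v_k = e_k v_k` with
FLAT moduli `|v_k(x)|² = 1/|Λ|` (plane waves on a torus). For the `|Λ| × 2` frames
`F_{k,w} = [v_k | 1_w v_k]` and the `2 × 2` cost matrices
`C_k = [[-e_k + μ, λ/2], [λ/2, U/2 - λ]]` one has the exact resolution
  `Σ_k F_{k,w} C_k F_{k,w}ᴴ = A_w + μ·1`            (`sum_twoPoleFrame_conj`, completeness),
  `F_{k,w}ᴴ F_{k,w} = M(|w|/|Λ|)`, `M(ρ) = [[1, ρ], [ρ, ρ]]`   (`conjTranspose_twoPoleFrame_mul`, flatness),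
for every real `μ, λ` (they cancel in the sum). If `T_k ⪰ 0` and `C_k + T_k ⪰ 0` then
`dΓ_σ(F C_k Fᴴ) = dΓ_σ(F (C_k + T_k) Fᴴ) - dΓ_σ(F T_k Fᴴ) ≥ -tr(T_k M(|w|/|Λ|)) ‖φ‖²`
(`re_rayleigh_dGammaSpin_frame_ge`: a positive one-body operator has `dΓ ≥ 0`, and
`dΓ(B) ≤ tr B` for `B ⪰ 0` by Pauli, `LangerMattis.sum_min_eigenvalues_mul_normSq_le`). On the sector
`N_τ = n_τ` only the blocks `|w| = n_τ` survive, whence (`re_rayleigh_speciesHamiltonian_ge_twoPole`)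
  `Re ⟨ψ, H_σ ψ⟩ ≥ -(Σ_k tr(T_k M(n_τ/|Λ|))) ‖ψ‖² - μ Re ⟨ψ, N_σ ψ⟩`,
and summing the two species on the `(n, n)` sector, which carries the `2n`-particle ground energy
(`groundEnergyAt_eq_minEnergyOn_szSector`, Lieb 1989):
  `E_G(2n) ≥ -Σ_σ (Σ_k tr(T_{σ,k} M(n/|Λ|)) + μ_σ n)`      (`groundEnergyAt_ge_twoPole`),
for every choice of `μ_σ, λ_σ ∈ ℝ` and certificates `T_{σ,k}`; on the torus `(ℤ/Lℤ)^d`, `L ≥ 3`,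
with the site plane waves and `e_k = 2t Σ_i cos(2πk_i/L)` (`hubbardTorus_groundEnergyAt_ge_twoPole`).
The optimum over `T_k` is `σ₋(C_k M)`, the sum of the negative eigenvalues of `C_k M` (a `2 × 2`
semidefinite programme; NOT typed here — the certificate form is what a checker consumes), so the
supremum of the bound over the certificates is the "two-pole" functional
`E₀ ≥ sup_{μ,λ} [2 Σ_k σ₋(ε_k; μ, λ) - 2μn]` of the cell's memo `TWOPOLE-NU.md` §2 (numbers there are
the memo's, not this file's). Sanity instance: at `U = 0`, `λ = 0`, `T_k = [[(e_k - μ)⁺, 0], [0, 0]]`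
the bound is `2 (Σ_k min(ε_k + μ, 0) - μ n)`, whose supremum over `μ` is the free Fermi-sea energy.
No bipartiteness and no sign of `U` is used.

All statements are PROVED (no named facts, no placeholders); the only inputs are the imported tree
files.

References: Langer–Mattis, Phys. Lett. A 36 (1971) 139, eq. (5) [cite: LangerMattis1971, eq. (5)];
Lieb–Loss, Duke Math. J. 71 (1993) 337, §8 Theorem 8.2 [cite: LiebLoss1993, §8 Theorem 8.2];
Kennedy–Lieb, Physica A 138 (1986) 320, Theorem 2.1 [cite: KennedyLieb1986, Theorem 2.1];
Lieb, PRL 62 (1989) 1201, proof of Theorem 1 [cite: LiebPRL1989, proof of Theorem 1].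

FILE SPLIT (FILER lit g33, 2026-08-26; mathematics byte-identical to the staged seat source
`pub-hubbard-pseudo/lean-staged/HubbardTwoPoleBound.lean` sha256 3869974ba3a8f579…, pseudo g63): the gate caps
proof-carrying `Summits` files at 400 lines, so the staged 448-line file is filed as TWO modules — this one (one-body
part: `dΓ_σ` positivity / Pauli / frame certificate, the two-mode frame, cost and Gram matrices, the resolution of
`A_w` and the Gram identity; staged lines 56–252) and `HubbardTwoPoleBound` (the species inequality, the joint-sector
and ground-state bounds, the torus instance; staged lines 254–448). The mechanism paragraph below covers both.
-/

namespace Summit.HubbardSuperconductivity.HubbardLadder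

open Matrix Finset Literature.MathematicalPhysics.QuantumLattice
  Literature.MathematicalPhysics.QuantumLattice.LangerMattis
  Literature.MathematicalPhysics.QuantumLattice.RayleighBound
open scoped ComplexOrder ComplexConjugate

section General

variable {Λ : Type*} [LinearOrder Λ] [Fintype Λ]

/-! ### `dΓ_σ` of positive one-body operators -/

/-- `dΓ_σ(-A) = -dΓ_σ(A)`. [folklore] -/
theorem dGammaSpin_neg (σ : Fin 2) (A : Matrix Λ Λ ℂ) : dGammaSpin σ (-A) = -dGammaSpin σ A := by
  rw [← neg_one_smul ℂ A, dGammaSpin_smul, neg_one_smul]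

/-- `dΓ_σ(0) = 0`. [folklore] -/
theorem dGammaSpin_zero (σ : Fin 2) : dGammaSpin σ (0 : Matrix Λ Λ ℂ) = 0 := by
  simp only [dGammaSpin, Matrix.zero_apply, zero_smul, Finset.sum_const_zero]

/-- `dΓ_σ` of a finite sum. [folklore] -/
theorem dGammaSpin_sum (σ : Fin 2) {ι : Type*} (s : Finset ι) (A : ι → Matrix Λ Λ ℂ) :
    dGammaSpin σ (∑ i ∈ s, A i) = ∑ i ∈ s, dGammaSpin σ (A i) := by
  classical
  refine Finset.induction_on s (by rw [Finset.sum_empty, Finset.sum_empty, dGammaSpin_zero]) ?_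
  intro i s hi ih
  rw [Finset.sum_insert hi, Finset.sum_insert hi, dGammaSpin_add, ih]

/-- **A positive one-body operator has `dΓ_σ(A) ≥ 0`**: `0 ≤ Re ⟨φ, dΓ_σ(A) φ⟩` for `A ⪰ 0`
(all eigenvalues `≥ 0` in Lieb–Loss' bound `dΓ(A) ≥ Σ_i min(λ_i, 0)`).
[cite: LiebLoss1993, §8 Theorem 8.2] -/
theorem re_rayleigh_dGammaSpin_nonneg (σ : Fin 2) {A : Matrix Λ Λ ℂ} (hA : A.PosSemidef)
    (φ : Fock (Orb Λ)) : 0 ≤ (star φ ⬝ᵥ (dGammaSpin σ A *ᵥ φ)).re := by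
  have h := sum_min_eigenvalues_mul_normSq_le σ hA.1 φ
  have h0 : ∑ i, min (hA.1.eigenvalues i) 0 = 0 :=
    Finset.sum_eq_zero fun i _ => min_eq_right (hA.eigenvalues_nonneg i)
  rwa [h0, zero_mul] at h

/-- **Pauli bound for a positive one-body operator**: `Re ⟨φ, dΓ_σ(A) φ⟩ ≤ (tr A) ‖φ‖²` for `A ⪰ 0`
(Lieb–Loss' bound applied to `-A`, whose eigenvalues are all `≤ 0` and sum to `-tr A`).
[cite: LiebLoss1993, §8 Theorem 8.2] -/
theorem re_rayleigh_dGammaSpin_le_trace (σ : Fin 2) {A : Matrix Λ Λ ℂ} (hA : A.PosSemidef)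
    (φ : Fock (Orb Λ)) : (star φ ⬝ᵥ (dGammaSpin σ A *ᵥ φ)).re ≤ A.trace.re * normSq φ := by
  have hn : (-A).IsHermitian := hA.1.neg
  have hle : ∀ i, hn.eigenvalues i ≤ 0 := fun i => by
    rw [hn.eigenvalues_eq, Matrix.neg_mulVec, dotProduct_neg, map_neg, neg_nonpos]
    exact hA.re_dotProduct_nonneg _
  have hsum : ∑ i, min (hn.eigenvalues i) 0 = -A.trace.re := by
    rw [Finset.sum_congr rfl fun i _ => min_eq_left (hle i),
      ← FalicovKimball.re_trace_eq_sum_eigenvalues hn, Matrix.trace_neg, Complex.neg_re]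
  have h := sum_min_eigenvalues_mul_normSq_le σ hn φ
  rw [hsum, dGammaSpin_neg, Matrix.neg_mulVec, dotProduct_neg, Complex.neg_re] at h
  linarith

/-- **The frame certificate.** For a frame `F : Λ × m`, a cost matrix `C` and a certificate `T ⪰ 0`
with `C + T ⪰ 0`:  `Re ⟨φ, dΓ_σ(F C Fᴴ) φ⟩ ≥ -Re tr(T · FᴴF) ‖φ‖²`
(`F C Fᴴ = F(C+T)Fᴴ - F T Fᴴ`, the first `⪰ 0`, the second `⪰ 0` with trace `tr(T FᴴF)`).
[cite: LiebLoss1993, §8 Theorem 8.2] -/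
theorem re_rayleigh_dGammaSpin_frame_ge (σ : Fin 2) {m : Type*} [Fintype m] (F : Matrix Λ m ℂ)
    {C T : Matrix m m ℂ} (hT : T.PosSemidef) (hCT : (C + T).PosSemidef) (φ : Fock (Orb Λ)) :
    -((T * (Fᴴ * F)).trace.re) * normSq φ ≤
      (star φ ⬝ᵥ (dGammaSpin σ (F * C * Fᴴ) *ᵥ φ)).re := by
  have h1 : F * C * Fᴴ = F * (C + T) * Fᴴ + -(F * T * Fᴴ) := by
    rw [Matrix.mul_add, Matrix.add_mul]
    abel
  have hA := re_rayleigh_dGammaSpin_nonneg σ (hCT.mul_mul_conjTranspose_same F) φ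
  have hB := re_rayleigh_dGammaSpin_le_trace σ (hT.mul_mul_conjTranspose_same F) φ
  have htr : (F * T * Fᴴ).trace = (T * (Fᴴ * F)).trace := by
    rw [Matrix.mul_assoc, Matrix.trace_mul_comm, Matrix.mul_assoc]
  rw [h1, dGammaSpin_add, dGammaSpin_neg, Matrix.add_mulVec, Matrix.neg_mulVec, dotProduct_add,
    dotProduct_neg, Complex.add_re, Complex.neg_re, ← htr]
  linarith

/-! ### The two-mode frame, the cost matrix and the Gram matrix -/

/-- The two-mode frame `F_{v,w} = [v | 1_w v]` (`|Λ| × 2`): the mode `v` and its restriction to the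
site set `w` (on the range of `P^τ_w` the composite mode `Σ_x v(x) n_{xτ} c_{xσ}` IS the one-body mode
`c(1_w v)`). [cite: LangerMattis1971, eq. (5)] -/
def twoPoleFrame (v : Λ → ℂ) (w : Finset Λ) : Matrix Λ (Fin 2) ℂ :=
  Matrix.of fun x a => if a = 0 then v x else if x ∈ w then v x else 0

/-- The `2 × 2` cost matrix `C(ε; μ, λ) = [[ε + μ, λ/2], [λ/2, U/2 - λ]]` of a mode of kinetic energy
`ε`: chemical potential `μ` on the mode, the repulsion `U/2` on its `w`-restriction, and the free
multiplier `λ` of the redundancy `⟨v, 1_w v⟩ = ⟨1_w v, 1_w v⟩`. [folklore] -/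
noncomputable def twoPoleCost (U ε μ lam : ℝ) : Matrix (Fin 2) (Fin 2) ℂ :=
  !![((ε + μ : ℝ) : ℂ), ((lam / 2 : ℝ) : ℂ); ((lam / 2 : ℝ) : ℂ), ((U / 2 - lam : ℝ) : ℂ)]

/-- The Gram matrix `M(ρ) = [[1, ρ], [ρ, ρ]]` of the frame at density `ρ = |w|/|Λ|`. [folklore] -/
noncomputable def twoPoleGram (ρ : ℝ) : Matrix (Fin 2) (Fin 2) ℂ := !![(1 : ℂ), (ρ : ℂ); (ρ : ℂ), (ρ : ℂ)]

omit [Fintype Λ] in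
/-- Column `0` of the frame is the mode `v`. [folklore] -/
private theorem twoPoleFrame_apply_zero (v : Λ → ℂ) (w : Finset Λ) (x : Λ) :
    twoPoleFrame v w x 0 = v x := rfl

omit [Fintype Λ] in
/-- Column `1` of the frame is the restricted mode `1_w v`. [folklore] -/
private theorem twoPoleFrame_apply_one (v : Λ → ℂ) (w : Finset Λ) (x : Λ) :
    twoPoleFrame v w x 1 = if x ∈ w then v x else 0 := rfl

omit [Fintype Λ] in
/-- The entries of `F C Fᴴ`: `(F C Fᴴ)_{xy} = v(x) v̄(y) (C₀₀ + 1_w(y) C₀₁ + 1_w(x) C₁₀ + 1_w(x)1_w(y) C₁₁)`.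
[folklore] -/
theorem twoPoleFrame_conj_apply (v : Λ → ℂ) (w : Finset Λ) (C : Matrix (Fin 2) (Fin 2) ℂ)
    (x y : Λ) :
    (twoPoleFrame v w * C * (twoPoleFrame v w)ᴴ) x y =
      v x * star (v y) * (C 0 0 + (if y ∈ w then C 0 1 else 0) + (if x ∈ w then C 1 0 else 0) +
        (if x ∈ w ∧ y ∈ w then C 1 1 else 0)) := by
  simp only [Matrix.mul_apply, Matrix.conjTranspose_apply, Fin.sum_univ_two, Fin.isValue,
    twoPoleFrame_apply_zero, twoPoleFrame_apply_one]
  by_cases hx : x ∈ w <;> by_cases hy : y ∈ w <;> simp [hx, hy] <;> ring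

/-- Entry `(0,0)` of the cost matrix. [folklore] -/
private theorem twoPoleCost_apply_00 (U ε μ lam : ℝ) : twoPoleCost U ε μ lam 0 0 = ((ε + μ : ℝ) : ℂ) :=
  rfl
/-- Entry `(0,1)` of the cost matrix. [folklore] -/
private theorem twoPoleCost_apply_01 (U ε μ lam : ℝ) : twoPoleCost U ε μ lam 0 1 = ((lam / 2 : ℝ) : ℂ) :=
  rfl
/-- Entry `(1,0)` of the cost matrix. [folklore] -/
private theorem twoPoleCost_apply_10 (U ε μ lam : ℝ) : twoPoleCost U ε μ lam 1 0 = ((lam / 2 : ℝ) : ℂ) :=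
  rfl
/-- Entry `(1,1)` of the cost matrix. [folklore] -/
private theorem twoPoleCost_apply_11 (U ε μ lam : ℝ) :
    twoPoleCost U ε μ lam 1 1 = ((U / 2 - lam : ℝ) : ℂ) :=
  rfl

/-- **The resolution of `A_w`**: along a complete eigenbasis `tA_G v_k = e_k v_k`,
`Σ_k F_{k,w} C(-e_k; μ, λ) F_{k,w}ᴴ = A_w + μ·1` for all real `μ, λ` (`A_w = LangerMattis.lmOneBody`).
[cite: LangerMattis1971, eq. (5)] -/
theorem sum_twoPoleFrame_conj (G : SimpleGraph Λ) [DecidableRel G.Adj] (t U μ lam : ℝ)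
    (w : Finset Λ) {κ : Type*} [Fintype κ] (v : κ → Λ → ℂ) (e : κ → ℝ)
    (hv : ∀ x y : Λ, ∑ k, v k x * star (v k y) = if x = y then 1 else 0)
    (heig : ∀ k, hopMatrix G t *ᵥ v k = ((e k : ℝ) : ℂ) • v k) :
    ∑ k, twoPoleFrame (v k) w * twoPoleCost U (-(e k)) μ lam * (twoPoleFrame (v k) w)ᴴ =
      lmOneBody G t U w + ((μ : ℝ) : ℂ) • (1 : Matrix Λ Λ ℂ) := by
  ext x y
  -- the `k`-independent part of the bracket
  set c : ℂ := (μ : ℂ) + (if y ∈ w then ((lam / 2 : ℝ) : ℂ) else 0) +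
    (if x ∈ w then ((lam / 2 : ℝ) : ℂ) else 0) + (if x ∈ w ∧ y ∈ w then ((U / 2 - lam : ℝ) : ℂ) else 0)
    with hc
  have hk : ∀ k, (twoPoleFrame (v k) w * twoPoleCost U (-(e k)) μ lam * (twoPoleFrame (v k) w)ᴴ) x y
      = -((e k : ℂ) * (v k x * star (v k y))) + c * (v k x * star (v k y)) := fun k => by
    rw [twoPoleFrame_conj_apply, twoPoleCost_apply_00, twoPoleCost_apply_01, twoPoleCost_apply_10,
      twoPoleCost_apply_11, hc]
    push_cast
    ring
  rw [Matrix.sum_apply, Finset.sum_congr rfl fun k _ => hk k, Finset.sum_add_distrib,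
    Finset.sum_neg_distrib, ← Finset.mul_sum, ← HubbardBandBottom.apply_eq_sum_eigenmodes (hopMatrix G t) v e hv heig x y,
    hv x y, Matrix.add_apply, Matrix.smul_apply, Matrix.one_apply, lmOneBody, hopMatrix, Matrix.of_apply,
    Matrix.of_apply, smul_eq_mul, hc]
  by_cases hxy : x = y
  · subst hxy
    by_cases hx : x ∈ w
    · simp [hx]
      ring
    · simp [hx]
  · simp [hxy]
    split_ifs <;> simp

/-- **The Gram matrix of the frame** for a FLAT mode `|v(x)|² = 1/|Λ|`: `Fᴴ F = M(|w|/|Λ|)`.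
[folklore] -/
theorem conjTranspose_twoPoleFrame_mul (v : Λ → ℂ) (w : Finset Λ)
    (hflat : ∀ x, v x * star (v x) = ((Fintype.card Λ : ℂ))⁻¹) (hcard : 0 < Fintype.card Λ) :
    (twoPoleFrame v w)ᴴ * twoPoleFrame v w = twoPoleGram ((w.card : ℝ) / Fintype.card Λ) := by
  have hflat' : ∀ x, star (v x) * v x = ((Fintype.card Λ : ℂ))⁻¹ := fun x => by rw [mul_comm, hflat]
  have hc : (Fintype.card Λ : ℂ) ≠ 0 := by exact_mod_cast hcard.ne'
  have h00 : ∑ x, star (v x) * v x = 1 := by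
    simp_rw [hflat']
    rw [Finset.sum_const, Finset.card_univ, nsmul_eq_mul, mul_inv_cancel₀ hc]
  have h01 : ∑ x, star (v x) * (if x ∈ w then v x else 0) = (w.card : ℂ) * ((Fintype.card Λ : ℂ))⁻¹ := by
    simp_rw [mul_ite, mul_zero, hflat']
    rw [Finset.sum_ite_mem, Finset.univ_inter, Finset.sum_const, nsmul_eq_mul]
  have h10 : ∑ x, star (if x ∈ w then v x else 0) * v x = (w.card : ℂ) * ((Fintype.card Λ : ℂ))⁻¹ := by
    have : ∀ x, star (if x ∈ w then v x else 0) * v x = if x ∈ w then ((Fintype.card Λ : ℂ))⁻¹ else 0 :=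
      fun x => by
        split_ifs
        · exact hflat' x
        · rw [star_zero, zero_mul]
    simp_rw [this]
    rw [Finset.sum_ite_mem, Finset.univ_inter, Finset.sum_const, nsmul_eq_mul]
  have h11 : ∑ x, star (if x ∈ w then v x else 0) * (if x ∈ w then v x else 0) =
      (w.card : ℂ) * ((Fintype.card Λ : ℂ))⁻¹ := by
    have : ∀ x, star (if x ∈ w then v x else 0) * (if x ∈ w then v x else 0) =
        if x ∈ w then ((Fintype.card Λ : ℂ))⁻¹ else 0 := fun x => by
      split_ifs
      · exact hflat' x
      · rw [star_zero, zero_mul]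
    simp_rw [this]
    rw [Finset.sum_ite_mem, Finset.univ_inter, Finset.sum_const, nsmul_eq_mul]
  have hρ : ((((w.card : ℝ) / Fintype.card Λ : ℝ)) : ℂ) = (w.card : ℂ) * ((Fintype.card Λ : ℂ))⁻¹ := by
    push_cast
    rw [div_eq_mul_inv]
  rw [Matrix.eta_fin_two ((twoPoleFrame v w)ᴴ * twoPoleFrame v w)]
  simp only [Matrix.mul_apply, Matrix.conjTranspose_apply, twoPoleFrame_apply_zero,
    twoPoleFrame_apply_one]
  rw [h00, h01, h10, h11, twoPoleGram, hρ]

end General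

end Summit.HubbardSuperconductivity.HubbardLadder
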